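import Mathlib.FieldTheory.RatFunc.AsPolynomial
import Mathlib.FieldTheory.Perfect
import Mathlib.FieldTheory.Separable
import Mathlib.RingTheory.Polynomial.GaussLemma
import Mathlib.RingTheory.LaurentSeries
import Literature.FieldTheory.AlgClosed.NewtonPuiseux
import Literature.FieldTheory.AlgClosed.NewtonPuiseuxProofs
import HarnessLib

/-!
# Puiseux expansions at infinity of a plane curve: the formal normal form

Let `k` be an algebraically closed field of characteristic `0` and `Q ∈ k[X][Y]` an irreducible
polynomial of positive `Y`-degree `d`. The `d` roots `y(u)` of `Q(u, ·)` for `u → ∞` are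
Laurent–Puiseux series in `u^{-1/e}`: this file produces the FORMAL data from which the
convergent statement is deduced in `Literature/Analysis/Complex/PuiseuxAtInfinity.lean`:
a ramification index `e ≥ 1`, an integer `M ≥ 0`, a polynomial `Q' ∈ k[X][Y]` with
`deg_Y Q' ≤ d` whose top coefficient `c = [Y^d] Q'` satisfies `c(0) ≠ 0`, and `d` pairwise
distinct power series `r_i ∈ k⟦t⟧` with the formal factorisation
`Q'(t, Y) = c(t) ∏ᵢ (Y - rᵢ(t))` coefficientwise in `k⟦t⟧`, together with the evaluation identity
`Q'(t, t^M v) = 0 ↔ Q(t^{-e}, v) = 0` for `t ∈ kˣ` (`exists_formal_normal_form_at_infinity`).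

Proof: substitute `u = x⁻¹` (the embedding `k[u] ↪ k⸨x⸩`, `u ↦ x⁻¹`, `polyAtInfty`), note that
`Q` stays separable over `k⸨x⸩` (Gauss's lemma and perfectness of `k(u)`), split it over
`k⸨t⸩`, `x = tᵉ`, by the Newton–Puiseux theorem (`NewtonPuiseux_holds`, Serre, *Local Fields*
IV §2 Prop. 8), and clear the poles of the roots and of the coefficients by `Y ↦ t^M Y` and a
power of `t`. [folklore]

## References

* J.-P. Serre, *Local Fields*, GTM 67, Ch. IV §2, Prop. 8 (formal Puiseux theorem).
* E. Brieskorn, H. Knörrer, *Plane Algebraic Curves*, Birkhäuser 1986, §8.3 (Puiseux expansions,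
  branches at infinity). [folklore]
-/

noncomputable section

open Polynomial HahnSeries LaurentSeries
open Literature.Barriers.ResolutionOfSingularities (ramify ramify_single)

namespace Literature.FieldTheory.AlgClosed

namespace PuiseuxInfinity

variable {k : Type*} [Field k]

/-! ### The embedding at infinity `k[u] ↪ k⸨x⸩`, `u ↦ x⁻¹` -/

/-- `q(x⁻¹) ∈ k⸨x⸩` for `q ∈ k[u]`: the image of `q` under the ring homomorphism `u ↦ x⁻¹`,
written as the finite sum `Σ_{j ≤ D} q_j x^{-j}` (`D ≥ deg q`). [folklore] -/
theorem eval₂_atInfty_eq_sum (q : k[X]) {D : ℕ} (hD : q.natDegree ≤ D) :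
    q.eval₂ (HahnSeries.C : k →+* k⸨X⸩) (single (-1 : ℤ) 1) =
      ∑ j ∈ Finset.range (D + 1), single (-(j : ℤ)) (q.coeff j) := by
  rw [eval₂_eq_sum_range' (HahnSeries.C : k →+* k⸨X⸩) (Nat.lt_succ_of_le hD)]
  refine Finset.sum_congr rfl fun j _ => ?_
  rw [single_pow, HahnSeries.C_apply, single_mul_single, one_pow, mul_one, zero_add]
  simp

/-- Coefficients of `q(x⁻¹)`: `[x^{-j}] q(x⁻¹) = q_j`. [folklore] -/
theorem coeff_eval₂_atInfty (q : k[X]) (j : ℕ) :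
    (q.eval₂ (HahnSeries.C : k →+* k⸨X⸩) (single (-1 : ℤ) 1)).coeff (-(j : ℤ)) = q.coeff j := by
  rw [eval₂_atInfty_eq_sum q (le_max_left q.natDegree j)]
  rw [HahnSeries.coeff_sum]  -- may not exist; fallback below
  rw [Finset.sum_eq_single j]
  · rw [coeff_single_same]
  · intro b _ hb
    rw [coeff_single_of_ne]
    intro h
    exact hb (by exact_mod_cast (neg_injective h).symm)
  · intro hj
    exact absurd (Finset.mem_range.2 (Nat.lt_succ_of_le (le_max_right _ _))) hj

/-- `u ↦ x⁻¹` is injective on `k[u]`. [folklore] -/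
theorem eval₂_atInfty_injective :
    Function.Injective fun q : k[X] => q.eval₂ (HahnSeries.C : k →+* k⸨X⸩) (single (-1 : ℤ) 1) := by
  intro p q h
  ext j
  have := congrArg (fun f : k⸨X⸩ => f.coeff (-(j : ℤ))) h
  simpa [coeff_eval₂_atInfty] using this

/-- The reversed-and-expanded polynomial `p(t) = Σ_{j ≤ D} q_j t^{e(D-j)}` (so that
`p(t) = t^{eD} q(t^{-e})`). [folklore] -/
theorem eval_revExpand (q : k[X]) (e D : ℕ) (t : k) (ht : t ≠ 0) (hD : q.natDegree ≤ D) :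
    (∑ j ∈ Finset.range (D + 1), Polynomial.C (q.coeff j) * X ^ (e * (D - j))).eval t =
      t ^ (e * D) * q.eval (t ^ e)⁻¹ := by
  rw [eval_finsetSum, eval_eq_sum_range' (Nat.lt_succ_of_le hD), Finset.mul_sum]
  refine Finset.sum_congr rfl fun j hj => ?_
  have hjD : j ≤ D := Nat.lt_succ_iff.1 (Finset.mem_range.1 hj)
  rw [eval_mul, eval_C, eval_pow, eval_X, inv_pow, ← pow_mul]
  have hte : t ^ (e * j) ≠ 0 := pow_ne_zero _ ht
  field_simp
  rw [mul_assoc, ← pow_add]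
  congr 2
  rw [← Nat.mul_add, Nat.sub_add_cancel hjD]

/-- The Laurent series of the monomial `a tⁿ`. [folklore] -/
theorem ofPowerSeries_coe_C_mul_X_pow (a : k) (n : ℕ) :
    ofPowerSeries ℤ k ((Polynomial.C a * X ^ n : k[X]) : PowerSeries k) = single (n : ℤ) a := by
  rw [Polynomial.coe_mul, Polynomial.coe_C, Polynomial.coe_pow, Polynomial.coe_X, map_mul, map_pow,
    ofPowerSeries_C, ofPowerSeries_X, single_pow, HahnSeries.C_apply, single_mul_single]
  simp

/-- The power series of a finite sum of polynomials is the sum of the power series. [folklore] -/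
theorem coe_polynomial_sum {α : Type*} (s : Finset α) (f : α → k[X]) :
    (((∑ j ∈ s, f j : k[X]) : PowerSeries k)) = ∑ j ∈ s, ((f j : k[X]) : PowerSeries k) := by
  rw [← Polynomial.coeToPowerSeries.ringHom_apply, map_sum]
  simp only [Polynomial.coeToPowerSeries.ringHom_apply]

/-- In `k⸨t⸩`: `t^{eD} · q(t^{-e}) = p(t)` with `p` the reversed-and-expanded polynomial,
where `q(t^{-e})` is `ramify e (q(x⁻¹))`. [folklore] -/
theorem single_mul_ramify_eval₂_atInfty (q : k[X]) (e : ℕ) (he : 0 < e) (D : ℕ)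
    (hD : q.natDegree ≤ D) :
    single ((e * D : ℕ) : ℤ) (1 : k) *
        ramify k e he (q.eval₂ (HahnSeries.C : k →+* k⸨X⸩) (single (-1 : ℤ) 1)) =
      ofPowerSeries ℤ k ((∑ j ∈ Finset.range (D + 1),
        Polynomial.C (q.coeff j) * X ^ (e * (D - j)) : k[X]) : PowerSeries k) := by
  rw [eval₂_atInfty_eq_sum q hD, map_sum, Finset.mul_sum, coe_polynomial_sum,
    map_sum (ofPowerSeries ℤ k)]
  refine Finset.sum_congr rfl fun j hj => ?_
  have hjD : j ≤ D := Nat.lt_succ_iff.1 (Finset.mem_range.1 hj)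
  rw [ramify_single, single_mul_single, one_mul, ofPowerSeries_coe_C_mul_X_pow]
  congr 1
  push_cast [Nat.cast_sub hjD]
  ring

/-- The reversed-and-expanded polynomial of the top coefficient factors as `t^κ · c(t)` with
`c(0) ≠ 0`: restricting the defining sum to `j ≤ deg q`. [folklore] -/
theorem revExpand_eq_X_pow_mul (q : k[X]) (e D : ℕ) (hD : q.natDegree ≤ D) :
    (∑ j ∈ Finset.range (D + 1), Polynomial.C (q.coeff j) * X ^ (e * (D - j)) : k[X]) =
      X ^ (e * (D - q.natDegree)) *
        ∑ j ∈ Finset.range (q.natDegree + 1), Polynomial.C (q.coeff j) * X ^ (e * (q.natDegree - j)) := by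
  rw [Finset.mul_sum, Finset.sum_subset (Finset.range_mono (Nat.succ_le_succ hD))]
  · refine Finset.sum_congr rfl fun j _ => ?_
    by_cases hjd : j ≤ q.natDegree
    · rw [mul_left_comm, ← pow_add]
      congr 2
      rw [← Nat.mul_add]
      congr 1
      omega
    · rw [coeff_eq_zero_of_natDegree_lt (not_le.1 hjd), map_zero, zero_mul, zero_mul, mul_zero]
  · intro j _ hj'
    have hlt : q.natDegree < j := by
      simp only [Finset.mem_range, not_lt] at hj'
      omega
    rw [coeff_eq_zero_of_natDegree_lt hlt, map_zero, zero_mul, mul_zero]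

/-- The value at `0` of `c(t) = Σ_{j ≤ deg q} q_j t^{e(deg q - j)}` is the leading coefficient
of `q` (for `e ≥ 1`). [folklore] -/
theorem eval_zero_revExpand_natDegree (q : k[X]) {e : ℕ} (he : 0 < e) :
    (∑ j ∈ Finset.range (q.natDegree + 1),
        Polynomial.C (q.coeff j) * X ^ (e * (q.natDegree - j)) : k[X]).eval 0 = q.leadingCoeff := by
  rw [eval_finsetSum, Finset.sum_eq_single q.natDegree]
  · rw [eval_mul, eval_C, eval_pow, eval_X, Nat.sub_self, mul_zero, pow_zero, mul_one,
      Polynomial.leadingCoeff]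
  · intro j hj hjne
    have hjlt : j < q.natDegree :=
      lt_of_le_of_ne (Nat.lt_succ_iff.1 (Finset.mem_range.1 hj)) hjne
    have hpos : 0 < e * (q.natDegree - j) := Nat.mul_pos he (Nat.sub_pos_of_lt hjlt)
    rw [eval_mul, eval_pow, eval_X, zero_pow hpos.ne', mul_zero]
  · intro h
    exact absurd (Finset.self_mem_range_succ _) h

/-- An irreducible polynomial of positive degree over a domain is primitive. [folklore] -/
theorem isPrimitive_of_irreducible_of_natDegree_pos {R : Type*} [CommRing R] [IsDomain R]
    {g : R[X]} (hg : Irreducible g) (hdeg : 0 < g.natDegree) : g.IsPrimitive := by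
  rw [Polynomial.isPrimitive_iff_isUnit_of_C_dvd]
  rintro r ⟨q, hq⟩
  rcases hg.isUnit_or_isUnit hq with hu | hu
  · exact Polynomial.isUnit_C.mp hu
  · exfalso
    obtain ⟨u, -, rfl⟩ := Polynomial.isUnit_iff.mp hu
    rw [← C_mul] at hq
    rw [hq, natDegree_C] at hdeg
    exact lt_irrefl 0 hdeg

/-- **Separability at infinity.** An irreducible `Q ∈ k[u][Y]` of positive `Y`-degree
(`char k = 0`) stays separable over the Laurent series field `k⸨x⸩`, `u = x⁻¹`: it is primitive,
hence irreducible over `k(u)` (Gauss), hence separable there (`k(u)` is perfect), and `k(u)`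
embeds in `k⸨x⸩`. [folklore] -/
theorem separable_map_atInfty [CharZero k] {Q : Polynomial k[X]} (hirr : Irreducible Q)
    (hd : 0 < Q.natDegree) :
    (Q.map (eval₂RingHom (HahnSeries.C : k →+* k⸨X⸩) (single (-1 : ℤ) 1))).Separable := by
  have hprim : Q.IsPrimitive := isPrimitive_of_irreducible_of_natDegree_pos hirr hd
  have hirrK : Irreducible (Q.map (algebraMap k[X] (RatFunc k))) :=
    (hprim.irreducible_iff_irreducible_map_fraction_map (K := RatFunc k)).1 hirr
  have hsepK : (Q.map (algebraMap k[X] (RatFunc k))).Separable :=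
    PerfectField.separable_of_irreducible hirrK
  set φ : k[X] →+* k⸨X⸩ := eval₂RingHom (HahnSeries.C : k →+* k⸨X⸩) (single (-1 : ℤ) 1) with hφ
  have hφ0 : nonZeroDivisors k[X] ≤ (nonZeroDivisors k⸨X⸩).comap φ := by
    intro q hq
    refine mem_nonZeroDivisors_of_ne_zero fun h => nonZeroDivisors.ne_zero hq ?_
    exact eval₂_atInfty_injective (h.trans (by simp : (0 : k⸨X⸩) = (0 : k[X]).eval₂ _ _))
  have hmap : Q.map φ = (Q.map (algebraMap k[X] (RatFunc k))).map (RatFunc.liftRingHom φ hφ0) := by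
    rw [Polynomial.map_map, RatFunc.liftRingHom_comp_algebraMap]
  rw [hmap]
  exact hsepK.map

end PuiseuxInfinity

end Literature.FieldTheory.AlgClosed

end
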